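import Literature.Probability.RandomPlanarGeometry.SLEPointSwallowingIto
import Literature.Probability.RandomPlanarGeometry.SLEPointFlowStop
import Literature.Probability.RandomPlanarGeometry.CritPercSLESwallowedProofs
import HarnessLib

/-!
# Points of `ℍ` are a.s. swallowed by SLE_κ, `κ > 4` (Rohde–Schramm (2005), Lemma 6.5): proved; Thm 6.4 assembled

Topic `Probability/RandomPlanarGeometry`; theorems and two auxiliary stopping times. We **discharge
the named fact** `Literature.Probability.RandomPlanarGeometry.ae_swallowingTime_lt_top_of_four_lt` of
`CritPercSLESwallowing.lean` — S. Rohde, O. Schramm, *Basic properties of SLE*, Ann. of Math. 161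
(2005), **Lemma 6.5** (p. 906): "Let `z ∈ ℍ̄ ∖ {0}`. If `κ > 4`, then `P[τ(z) < ∞] = 1`" —
as `ae_swallowingTime_lt_top_of_four_lt_holds`, and with it **the named fact
`ae_isSwallowed_sleTrace` (Thm 6.4, first half: for `4 < κ < 8` every `z ∈ ℍ̄ ∖ {0}` is a.s.
swallowed)** through the tree's reduction `ae_isSwallowed_sleTrace_of_lemma65`
(`CritPercSLESwallowedProofs.lean`), as `ae_isSwallowed_sleTrace_holds`. Real points of Lemma 6.5
were already proved in the tree (`ae_sle_swallowingTime_ofReal_lt_top`: Lawler's one-point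
martingales and reflection); the new content is the interior case
`ae_swallowingTime_lt_top_of_im_pos`: **for `κ > 4` and `z ∈ ℍ`, a.s. `τ(z) < ∞`.**

Proof (the printed proof, p. 907, with its "sprint times" replaced by a quadratic-variation
argument). Let `b = 1 - 4/κ ∈ (0, 1)`, `zₜ = gₜ(z) - √κ Bₜ`, `h(z) = Im(θ z^b)`, and for `R > |z|`
let `σ = σ_{R,n}` be the exit time of `|z_{t∧ρₙ}|²` from `(-1, R²)` capped by the localizing time
`ρₙ` (`slePointExitLocTime`); along `[0, σ]`, `|zₜ| ≤ R` and the slope is bounded.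

* **Exit through the sphere is unlikely** (`measureReal_exists_normSq_ge_le`): `h(z_{t∧σ})` is a
  martingale (`martingale_swallowObs` with `F = swallowIm b`), `h ≥ 0`, and
  `h ≥ cos(πb/2) R^b` at an exit through `|z| = R`; so by optional stopping and Markov's
  inequality, `P[∃ t ≤ ρₙ, |zₜ| ≥ R] ≤ |z|^b/(cos(πb/2) R^b)` ("`h(z₀) = E[h(z_{τ*})] ≥
  inf{h(z) : |z| = R} P[|z_{τ*}| = R]`", p. 907), and letting `n → ∞`,
  `P[∃ t < τ(z), |zₜ| ≥ R] ≤ |z|^b/(cos(πb/2) R^b)`.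
* **No eternal confinement** (`measure_confined_eq_zero`): with `F = swallowRe b` the bounded
  drift-free observable `N = Re(θ z^b_{t∧σ})` has `E[(N_t - N_0)²] = E∫₀ᵗ D² ds ≤ 4R^{2b}`, while
  its diffusion coefficient satisfies `D² ≥ κ b² sin²(πb/2) R^{2(b-1)} > 0` on `[0, σ]`; hence
  `P[σ_{R,n} ≥ t] ≤ C_R/t`. On the event "`τ(z) = ∞` and `|zₜ| < R` for all `t`" one has
  `σ_{R,n} = ρₙ ≥ t` for all large `n`, for every `t`; so this event is null.
* Hence `P[τ(z) = ∞] ≤ |z|^b/(cos(πb/2) R^b) → 0` as `R → ∞`.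

## References

* S. Rohde, O. Schramm, *Basic properties of SLE*, Ann. of Math. 161 (2005), Lemma 6.5 and its
  proof (pp. 906–907).
* G. F. Lawler, *Conformally Invariant Processes in the Plane*, AMS (2005), Prop. 6.8.
-/

noncomputable section

open Set Filter MeasureTheory Complex
open _root_.Topology
open scoped NNReal ENNReal

namespace Literature.Probability.RandomPlanarGeometry

open Loewner Literature.Probability.Process Literature.Analysis.FunctionSpaces

/-! ### The exit time of `|z_{t∧ρₙ}|²` from `(-1, R²)`, capped by `ρₙ` -/

section ExitTime

variable (κ : ℝ≥0) (z : ℂ) (R : ℝ) (n : ℕ)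

/-- The exit time of the gauge `Q = |z_{t∧ρₙ}|²` (`slePointNormSqStop`) from `(-1, R²)`, i.e. the
first time `|z_{t∧ρₙ}| ≥ R` (Rohde–Schramm's `τ_R`, p. 907, localized). [cite: RohdeSchramm2005, Lemma 6.5 (proof)] -/
def slePointExitTime : (ℝ≥0 → ℝ) → WithTop ℝ≥0 :=
  exitTime (slePointNormSqStop κ z n) (-1) (R ^ 2)

/-- Rohde–Schramm's `τ* = τ_R ∧ T`, here `σ = τ_R ∧ ρₙ` with the localizing time `ρₙ` in place of
the deterministic `T`. [cite: RohdeSchramm2005, Lemma 6.5 (proof)] -/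
def slePointExitLocTime (ω : ℝ≥0 → ℝ) : WithTop ℝ≥0 :=
  min (slePointExitTime κ z R n ω) (slePointLocTime κ z n ω)

variable {κ z R n}

/-- The gauge is adapted. [folklore] -/
theorem adapted_slePointNormSqStop (hz : 0 < z.im) :
    Adapted brownianFiltration (slePointNormSqStop κ z n) := fun t ↦ by
  have hX := (stronglyAdapted_slePointReStop κ hz n t).measurable
  have hY := (stronglyAdapted_slePointImStop κ hz n t).measurable
  exact (hX.pow_const 2).add (hY.pow_const 2)

/-- `σ` is a stopping time of the raw Brownian filtration. [folklore] -/
theorem isStoppingTime_slePointExitLocTime (hz : 0 < z.im) :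
    IsStoppingTime brownianFiltration (slePointExitLocTime κ z R n) :=
  (isStoppingTime_exitTime (adapted_slePointNormSqStop hz) (continuous_slePointNormSqStop hz)).min
    (isStoppingTime_slePointLocTime κ hz n)

/-- `σ ≤ ρₙ`. [folklore] -/
theorem slePointExitLocTime_le_locTime (ω : ℝ≥0 → ℝ) :
    slePointExitLocTime κ z R n ω ≤ slePointLocTime κ z n ω := min_le_right _ _

/-- The gauge starts inside `(-1, R²)` when `|z| < R`. [folklore] -/
theorem slePointNormSqStop_zero_mem (hz : 0 < z.im) (hR : Complex.normSq z < R ^ 2) (ω : ℝ≥0 → ℝ) :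
    slePointNormSqStop κ z n 0 ω ∈ Ioo (-1) (R ^ 2) := by
  rw [slePointNormSqStop, slePointReStop_zero hz, slePointImStop_zero hz]
  rw [Complex.normSq_apply] at hR
  refine ⟨by nlinarith [sq_nonneg z.re, sq_nonneg z.im], by nlinarith⟩

/-- **Up to `σ` the flow stays in the closed ball**: `|zₛ|² ≤ R²` for `s ≤ σ` (inside the interval
before the exit time, at the endpoint `R²` at it). [folklore] -/
theorem normSq_centredMap_le_of_le (hz : 0 < z.im) (hR : Complex.normSq z < R ^ 2) {ω : ℝ≥0 → ℝ}
    {s : ℝ≥0} (hs : (s : WithTop ℝ≥0) ≤ slePointExitLocTime κ z R n ω) :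
    Complex.normSq (centredMap (sleDriving κ ω) s z) ≤ R ^ 2 := by
  have hsρ : (s : WithTop ℝ≥0) ≤ slePointLocTime κ z n ω := hs.trans (min_le_right _ _)
  have hsH : (s : WithTop ℝ≥0) ≤ slePointExitTime κ z R n ω := hs.trans (min_le_left _ _)
  rw [← slePointNormSqStop_eq_of_le hz hsρ]
  rcases hsH.lt_or_eq with hlt | heq
  · exact (mem_Ioo_of_coe_lt_exitTime hlt).2.le
  · rcases apply_eq_or_eq_of_exitTime_eq_coe (continuous_slePointNormSqStop hz ω)
      (slePointNormSqStop_zero_mem hz hR ω) heq.symm with h | h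
    · have h0 : 0 ≤ slePointNormSqStop κ z n s ω := by rw [slePointNormSqStop]; positivity
      linarith
    · exact h.le

/-- **The slope is bounded up to `σ`**: `|xₛ/yₛ| ≤ R (n+2)/im z` for `s ≤ σ`
(`|xₛ| ≤ |zₛ| ≤ R`, `yₛ ≥ im z/(n+2)` on `[0, ρₙ]`). [folklore] -/
theorem abs_cotArg_le_of_le (hz : 0 < z.im) (hR0 : 0 < R) (hR : Complex.normSq z < R ^ 2)
    (ω : ℝ≥0 → ℝ) (s : ℝ≥0) (hs : (s : WithTop ℝ≥0) ≤ slePointExitLocTime κ z R n ω) :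
    |cotArg (sleDriving κ ω) z s| ≤ R * ((n + 2) / z.im) := by
  have hsρ : (s : WithTop ℝ≥0) ≤ slePointLocTime κ z n ω := hs.trans (min_le_right _ _)
  have hsT := coe_lt_swallowingTime_of_le_locTime hz hsρ
  have hQ := normSq_centredMap_le_of_le hz hR hs
  set Z := centredMap (sleDriving κ ω) s z with hZ
  have hy : z.im / (n + 2) ≤ Z.im := by
    have := level_le_slePointIm hz hsρ (κ := κ)
    rwa [slePointIm_of_lt hsT] at this
  have hl0 : 0 < z.im / (n + 2) := (level_pos_lt hz n).1
  have hypos : 0 < Z.im := hl0.trans_le hy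
  have hx : |Z.re| ≤ R := by
    rw [Complex.normSq_apply] at hQ
    refine abs_le_of_sq_le_sq' ?_ hR0.le |>.elim (fun h1 h2 ↦ abs_le.2 ⟨h1, h2⟩)
    nlinarith [sq_nonneg Z.im]
  rw [cotArg_apply, abs_div, abs_of_pos hypos, div_le_iff₀ hypos]
  calc |Z.re| ≤ R := hx
    _ = R * ((n + 2) / z.im) * (z.im / (n + 2)) := by field_simp
    _ ≤ R * ((n + 2) / z.im) * Z.im := mul_le_mul_of_nonneg_left hy (by positivity)

end ExitTime

/-! ### Exit through the sphere `|z| = R` is unlikely -/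

section Sphere

variable {κ : ℝ≥0} {z : ℂ}

/-- `b = 1 - 4/κ ∈ (0, 1)` for `κ > 4`. [folklore] -/
theorem rsB_mem (hκ : 4 < κ) : 1 - 4 / (κ : ℝ) ∈ Ioo (0 : ℝ) 1 := by
  have hκ' : (4 : ℝ) < κ := by exact_mod_cast hκ
  constructor
  · rw [sub_pos, div_lt_one (by linarith)]; exact hκ'
  · have : 0 < 4 / (κ : ℝ) := by positivity
    linarith

/-- **`P[|zₜ| ≥ R for some t ≤ ρₙ] ≤ |z|^b/(cos(πb/2) R^b)`** for `κ > 4`, `z ∈ ℍ`, `R > |z|`,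
`b = 1 - 4/κ`: optional stopping of the non-negative martingale `h(z_{t∧σ}) = Im(θ z^b_{t∧σ})`
(`integral_swallowObs`, `F = swallowIm b`) at `σ = τ_R ∧ ρₙ`, evaluated at time `n + 1 ≥ ρₙ`,
where `h ≥ cos(πb/2) R^b` on an exit through the sphere (`cos_mul_le_swallowIm`), and Markov's
inequality. Rohde–Schramm (2005), p. 907: "`h(z₀) = E[h(z_{τ*})] ≥ inf{h(z) : |z| = R}·P[|z_{τ*}| = R]`".
[cite: RohdeSchramm2005, Lemma 6.5 (proof)] -/
theorem measureReal_exists_normSq_ge_le (hκ : 4 < κ) (hz : 0 < z.im) {R : ℝ} (hR0 : 0 < R)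
    (hR : Complex.normSq z < R ^ 2) (n : ℕ) :
    preWienerMeasure.real {ω | ∃ t : ℝ≥0, (t : WithTop ℝ≥0) ≤ slePointLocTime κ z n ω ∧
        R ^ 2 ≤ Complex.normSq (centredMap (sleDriving κ ω) t z)} ≤
      Real.sqrt (z.re ^ 2 + z.im ^ 2) ^ (1 - 4 / (κ : ℝ)) /
        (Real.cos (Real.pi * (1 - 4 / (κ : ℝ)) / 2) * R ^ (1 - 4 / (κ : ℝ))) := by
  haveI := isProbabilityMeasure_preWienerMeasure'
  have hκ0 : 0 < κ := lt_trans (by norm_num) hκ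
  have hκ0' : (κ : ℝ) ≠ 0 := by positivity
  set b : ℝ := 1 - 4 / (κ : ℝ) with hb
  obtain ⟨hb0, hb1⟩ := rsB_mem hκ
  set σ := slePointExitLocTime κ z R n with hσdef
  have hσ : IsStoppingTime brownianFiltration σ := isStoppingTime_slePointExitLocTime hz
  have hσρ : ∀ ω, σ ω ≤ slePointLocTime κ z n ω := slePointExitLocTime_le_locTime
  have hS := abs_cotArg_le_of_le (κ := κ) (n := n) hz hR0 hR
  set Obs := swallowObs κ z σ (swallowIm b) b with hObs
  have hode : ∀ w : ℝ, (κ : ℝ) / 2 * (1 + w ^ 2) * iteratedDeriv 2 (swallowIm b) w +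
      4 * w * deriv (swallowIm b) w - 2 * b * swallowIm b w = 0 := fun w ↦ swallowIm_ode hκ0' rfl w
  have hmart := martingale_swallowObs hκ0 hz (contDiff_two_swallowIm b) hode hσ hσρ hS
  set T : ℝ≥0 := (n : ℝ≥0) + 1 with hT
  -- the cosine constant and the threshold
  have hcos : 0 < Real.cos (Real.pi * b / 2) := by
    refine Real.cos_pos_of_mem_Ioo ⟨by nlinarith [Real.pi_pos], ?_⟩
    nlinarith [Real.pi_pos]
  set c : ℝ := Real.cos (Real.pi * b / 2) * R ^ b with hc
  have hcpos : 0 < c := mul_pos hcos (Real.rpow_pos_of_pos hR0 b)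
  -- non-negativity and integrability of the observable
  have hYpos : ∀ t ω, 0 < stoppedProcess (slePointIm κ z) σ t ω := fun t ω ↦
    stoppedProcess_slePointIm_pos hz hσρ t ω
  have hObs_nonneg : ∀ t ω, 0 ≤ Obs t ω := fun t ω ↦ by
    simp only [hObs, swallowObs]
    refine mul_nonneg ?_ (Real.rpow_pos_of_pos (hYpos t ω) b).le
    exact le_trans (mul_nonneg hcos.le (Real.rpow_nonneg (norm_nonneg _) _))
      (cos_mul_le_swallowIm hb0.le hb1.le _)
  have hint : Integrable (Obs T) preWienerMeasure := hmart.integrable T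
  -- the event implies `Obs T ≥ c`
  have hsub : {ω : ℝ≥0 → ℝ | ∃ t : ℝ≥0, (t : WithTop ℝ≥0) ≤ slePointLocTime κ z n ω ∧
      R ^ 2 ≤ Complex.normSq (centredMap (sleDriving κ ω) t z)} ⊆ {ω | c ≤ Obs T ω} := by
    rintro ω ⟨t, htρ, htR⟩
    simp only [mem_setOf_eq]
    -- the exit happens by time `t ≤ ρₙ`
    have hQt : slePointNormSqStop κ z n t ω ∉ Ioo (-1) (R ^ 2) := by
      rw [slePointNormSqStop_eq_of_le hz htρ]
      exact fun h ↦ not_lt.2 htR h.2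
    have hHle : slePointExitTime κ z R n ω ≤ t :=
      (exitTime_le_coe_iff (continuous_slePointNormSqStop hz ω)).2 ⟨t, le_rfl, hQt⟩
    have hσeq : σ ω = slePointExitTime κ z R n ω := min_eq_left (hHle.trans htρ)
    obtain ⟨T₀, hT₀⟩ := WithTop.ne_top_iff_exists.1 (ne_top_of_le_ne_top WithTop.coe_ne_top hHle)
    have hT₀t : T₀ ≤ t := by rw [← hT₀] at hHle; exact WithTop.coe_le_coe.1 hHle
    have hT₀ρ : ((T₀ : ℝ≥0) : WithTop ℝ≥0) ≤ slePointLocTime κ z n ω := (WithTop.coe_le_coe.2 hT₀t).trans htρ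
    have hT₀T : T₀ ≤ T := by
      have := hT₀ρ.trans (slePointLocTime_le n ω)
      rw [hT]
      exact WithTop.coe_le_coe.1 this
    -- the gauge at the exit time is `R²`
    have hQT₀ : slePointNormSqStop κ z n T₀ ω = R ^ 2 := by
      rcases apply_eq_or_eq_of_exitTime_eq_coe (continuous_slePointNormSqStop hz ω)
        (slePointNormSqStop_zero_mem hz hR ω) hT₀.symm with h | h
      · have h0 : 0 ≤ slePointNormSqStop κ z n T₀ ω := by rw [slePointNormSqStop]; positivity
        linarith
      · exact h
    -- the stopped processes at time `T = n + 1` sit at time `T₀`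
    have hclock : (min (T : WithTop ℝ≥0) (σ ω)).untopA = T₀ := by
      rw [hσeq, ← hT₀, min_eq_right (WithTop.coe_le_coe.2 hT₀T), WithTop.untopA_eq_untop WithTop.coe_ne_top,
        WithTop.untop_coe]
    have hX : stoppedProcess (slePointRe κ z) σ T ω = slePointRe κ z T₀ ω := by
      rw [stoppedProcess, hclock]
    have hY : stoppedProcess (slePointIm κ z) σ T ω = slePointIm κ z T₀ ω := by
      rw [stoppedProcess, hclock]
    set x := slePointRe κ z T₀ ω with hx
    set y := slePointIm κ z T₀ ω with hy
    have hypos : 0 < y := hY ▸ hYpos T ω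
    have hxy : x ^ 2 + y ^ 2 = R ^ 2 := by
      rw [← hQT₀, slePointNormSqStop, slePointReStop_eq_of_le hT₀ρ, slePointImStop_eq_of_le hT₀ρ]
    simp only [hObs, swallowObs, hX, hY]
    have h1 := cos_mul_le_swallowIm hb0.le hb1.le (x / y)
    have h2 := rpow_mul_norm_slope_rpow hypos b (x := x)
    rw [hxy, Real.sqrt_sq hR0.le] at h2
    calc c = Real.cos (Real.pi * b / 2) * (y ^ b * ‖((x / y : ℝ) : ℂ) + I‖ ^ b) := by rw [h2]
      _ = (Real.cos (Real.pi * b / 2) * ‖((x / y : ℝ) : ℂ) + I‖ ^ b) * y ^ b := by ring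
      _ ≤ swallowIm b (x / y) * y ^ b := mul_le_mul_of_nonneg_right h1 (Real.rpow_pos_of_pos hypos b).le
      _ = swallowIm b (x * y⁻¹) * y ^ b := by rw [div_eq_mul_inv]
  -- Markov
  have hmarkov := mul_meas_ge_le_integral_of_nonneg (ae_of_all _ (hObs_nonneg T)) hint c
  rw [integral_swallowObs hκ0 hz (contDiff_two_swallowIm b) hode hσ hσρ hS T] at hmarkov
  -- `h(z) ≤ |z|^b`
  have hstart : swallowIm b (z.re / z.im) * z.im ^ b ≤ Real.sqrt (z.re ^ 2 + z.im ^ 2) ^ b := by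
    have h1 : swallowIm b (z.re / z.im) ≤ ‖((z.re / z.im : ℝ) : ℂ) + I‖ ^ b :=
      (le_abs_self _).trans (abs_im_swallowPow_le b b _)
    have h2 := rpow_mul_norm_slope_rpow hz b (x := z.re)
    calc swallowIm b (z.re / z.im) * z.im ^ b ≤ ‖((z.re / z.im : ℝ) : ℂ) + I‖ ^ b * z.im ^ b :=
          mul_le_mul_of_nonneg_right h1 (Real.rpow_pos_of_pos hz b).le
      _ = Real.sqrt (z.re ^ 2 + z.im ^ 2) ^ b := by rw [mul_comm, h2]
  calc preWienerMeasure.real {ω | ∃ t : ℝ≥0, (t : WithTop ℝ≥0) ≤ slePointLocTime κ z n ω ∧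
        R ^ 2 ≤ Complex.normSq (centredMap (sleDriving κ ω) t z)}
      ≤ preWienerMeasure.real {ω | c ≤ Obs T ω} := measureReal_mono hsub (measure_ne_top _ _)
    _ ≤ (swallowIm b (z.re / z.im) * z.im ^ b) / c := by
        rw [le_div_iff₀ hcpos, mul_comm]; exact hmarkov
    _ ≤ Real.sqrt (z.re ^ 2 + z.im ^ 2) ^ b / c := div_le_div_of_nonneg_right hstart hcpos.le

/-- **`P[|zₜ| ≥ R for some t < τ(z)] ≤ |z|^b/(cos(πb/2) R^b)`** (`κ > 4`, `z ∈ ℍ`, `R > |z|`):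
the events of `measureReal_exists_normSq_ge_le` increase with `n` and exhaust `[0, τ(z))`
(`exists_le_slePointLocTime`). [cite: RohdeSchramm2005, Lemma 6.5 (proof)] -/
theorem measure_exists_normSq_ge_le (hκ : 4 < κ) (hz : 0 < z.im) {R : ℝ} (hR0 : 0 < R)
    (hR : Complex.normSq z < R ^ 2) :
    preWienerMeasure {ω | ∃ t : ℝ≥0, (t : WithTop ℝ≥0) < swallowingTime (sleDriving κ ω) z ∧
        R ^ 2 ≤ Complex.normSq (centredMap (sleDriving κ ω) t z)} ≤
      ENNReal.ofReal (Real.sqrt (z.re ^ 2 + z.im ^ 2) ^ (1 - 4 / (κ : ℝ)) /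
        (Real.cos (Real.pi * (1 - 4 / (κ : ℝ)) / 2) * R ^ (1 - 4 / (κ : ℝ)))) := by
  haveI := isProbabilityMeasure_preWienerMeasure'
  set G : ℕ → Set (ℝ≥0 → ℝ) := fun n ↦ {ω | ∃ t : ℝ≥0, (t : WithTop ℝ≥0) ≤ slePointLocTime κ z n ω ∧
      R ^ 2 ≤ Complex.normSq (centredMap (sleDriving κ ω) t z)} with hGdef
  have hGmono : Monotone G := fun m n hmn ω ⟨t, ht, htR⟩ ↦
    ⟨t, ht.trans (slePointLocTime_mono hz ω hmn), htR⟩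
  have hsub : {ω : ℝ≥0 → ℝ | ∃ t : ℝ≥0, (t : WithTop ℝ≥0) < swallowingTime (sleDriving κ ω) z ∧
      R ^ 2 ≤ Complex.normSq (centredMap (sleDriving κ ω) t z)} ⊆ ⋃ n, G n := by
    rintro ω ⟨t, ht, htR⟩
    obtain ⟨N, hN⟩ := exists_le_slePointLocTime hz ω ht
    exact mem_iUnion.2 ⟨N, t, hN N le_rfl, htR⟩
  refine (measure_mono hsub).trans ?_
  rw [hGmono.measure_iUnion]
  refine iSup_le fun n ↦ ?_
  rw [← ENNReal.ofReal_toReal (measure_ne_top _ _)]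
  exact ENNReal.ofReal_le_ofReal (measureReal_exists_normSq_ge_le hκ hz hR0 hR n)

end Sphere

/-! ### No eternal confinement in a ball -/

section Confinement

variable {κ : ℝ≥0} {z : ℂ}

/-- **The observable `Re(θ z^b_{t∧σ})` is bounded by `R^b`** along `σ = τ_R ∧ ρₙ` (`|zₛ| ≤ R` on
`[0, σ]`, `|Re(θ(w+i)^b)| ≤ |w+i|^b`, `y^b |x/y + i|^b = |z|^b`, `b ≥ 0`). [folklore] -/
theorem abs_swallowObs_re_le (hz : 0 < z.im) {R : ℝ} (hR0 : 0 < R) (hR : Complex.normSq z < R ^ 2)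
    {n : ℕ} {b : ℝ} (hb0 : 0 ≤ b) (t : ℝ≥0) (ω : ℝ≥0 → ℝ) :
    |swallowObs κ z (slePointExitLocTime κ z R n) (swallowRe b) b t ω| ≤ R ^ b := by
  set σ := slePointExitLocTime κ z R n with hσdef
  have hσρ : ∀ ω, σ ω ≤ slePointLocTime κ z n ω := slePointExitLocTime_le_locTime
  set u : ℝ≥0 := (min (t : WithTop ℝ≥0) (σ ω)).untopA with hu
  have huσ : (u : WithTop ℝ≥0) ≤ σ ω := coe_untopA_min_le t (σ ω)
  have huρ : (u : WithTop ℝ≥0) ≤ slePointLocTime κ z n ω := huσ.trans (hσρ ω)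
  have huT := coe_lt_swallowingTime_of_le_locTime hz huρ
  have hX : stoppedProcess (slePointRe κ z) σ t ω = (centredMap (sleDriving κ ω) u z).re := rfl
  have hY : stoppedProcess (slePointIm κ z) σ t ω = (centredMap (sleDriving κ ω) u z).im := by
    show slePointIm κ z u ω = _
    rw [slePointIm_of_lt huT]
  set x := (centredMap (sleDriving κ ω) u z).re
  set y := (centredMap (sleDriving κ ω) u z).im
  have hypos : 0 < y := by rw [← hY]; exact stoppedProcess_slePointIm_pos hz hσρ t ω
  have hQ : x ^ 2 + y ^ 2 ≤ R ^ 2 := by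
    have := normSq_centredMap_le_of_le hz hR huσ
    rwa [Complex.normSq_apply, ← sq, ← sq] at this
  simp only [swallowObs, hX, hY]
  rw [abs_mul, abs_of_pos (Real.rpow_pos_of_pos hypos b), swallowRe]
  have h1 := abs_re_swallowPow_le b b (x * y⁻¹)
  have h2 := rpow_mul_norm_slope_rpow hypos b (x := x)
  rw [div_eq_mul_inv] at h2
  calc |(swallowPow b b (x * y⁻¹)).re| * y ^ b ≤ ‖((x * y⁻¹ : ℝ) : ℂ) + I‖ ^ b * y ^ b :=
        mul_le_mul_of_nonneg_right h1 (Real.rpow_pos_of_pos hypos b).le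
    _ = Real.sqrt (x ^ 2 + y ^ 2) ^ b := by rw [mul_comm, h2]
    _ ≤ Real.sqrt (R ^ 2) ^ b := Real.rpow_le_rpow (Real.sqrt_nonneg _) (Real.sqrt_le_sqrt hQ) hb0
    _ = R ^ b := by rw [Real.sqrt_sq hR0.le]

/-- **The diffusion coefficient of `Re(θ z^b_{t∧σ})` is bounded below on `[0, σ]`**:
`D² ≥ κ (b sin(πb/2) R^{b-1})²` for `s ≤ σ = τ_R ∧ ρₙ` (`D = -√κ y^{b-1} G'(w)`,
`G'(w) = b Re(θ(w+i)^{b-1}) ≥ b sin(πb/2)|w+i|^{b-1}`, `y^{b-1}|x/y+i|^{b-1} = |z|^{b-1} ≥ R^{b-1}`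
as `|z| ≤ R` and `b ≤ 1`). [folklore] -/
theorem le_sq_swallowObsDiffusion_re (hz : 0 < z.im) {R : ℝ} (hR0 : 0 < R)
    (hR : Complex.normSq z < R ^ 2) {n : ℕ} {b : ℝ} (hb0 : 0 ≤ b) (hb1 : b ≤ 1) {s : ℝ≥0}
    {ω : ℝ≥0 → ℝ} (hs : (s : WithTop ℝ≥0) ≤ slePointExitLocTime κ z R n ω) :
    (κ : ℝ) * (b * Real.sin (Real.pi * b / 2) * R ^ (b - 1)) ^ 2 ≤
      swallowObsDiffusion κ z (slePointExitLocTime κ z R n) (swallowRe b) b s ω ^ 2 := by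
  set σ := slePointExitLocTime κ z R n with hσdef
  have hσρ : ∀ ω, σ ω ≤ slePointLocTime κ z n ω := slePointExitLocTime_le_locTime
  have hsρ : (s : WithTop ℝ≥0) ≤ slePointLocTime κ z n ω := hs.trans (hσρ ω)
  have hsT := coe_lt_swallowingTime_of_le_locTime hz hsρ
  have hX : stoppedProcess (slePointRe κ z) σ s ω = (centredMap (sleDriving κ ω) s z).re := by
    rw [stoppedProcess_eq_of_le hs]; rfl
  have hY : stoppedProcess (slePointIm κ z) σ s ω = (centredMap (sleDriving κ ω) s z).im := by
    rw [stoppedProcess_eq_of_le hs]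
    exact slePointIm_of_lt hsT
  set x := (centredMap (sleDriving κ ω) s z).re
  set y := (centredMap (sleDriving κ ω) s z).im
  have hypos : 0 < y := by rw [← hY]; exact stoppedProcess_slePointIm_pos hz hσρ s ω
  have hQ : x ^ 2 + y ^ 2 ≤ R ^ 2 := by
    have := normSq_centredMap_le_of_le hz hR hs
    rwa [Complex.normSq_apply, ← sq, ← sq] at this
  have hQpos : 0 < x ^ 2 + y ^ 2 := by positivity
  simp only [swallowObsDiffusion, hX, hY, trunc_of_le hs]
  rw [deriv_swallowRe]
  simp only
  -- the lower bound for `G'(w) y^{b-1}`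
  have hsin : 0 ≤ Real.sin (Real.pi * b / 2) :=
    Real.sin_nonneg_of_nonneg_of_le_pi (by positivity) (by nlinarith [Real.pi_pos])
  have h1 := sin_mul_le_re_swallowPow_sub_one hb0 hb1 (x * y⁻¹)
  have h2 := rpow_mul_norm_slope_rpow hypos (b - 1) (x := x)
  rw [div_eq_mul_inv] at h2
  have h3 : R ^ (b - 1) ≤ Real.sqrt (x ^ 2 + y ^ 2) ^ (b - 1) :=
    Real.rpow_le_rpow_of_nonpos (Real.sqrt_pos.2 hQpos)
      ((Real.sqrt_le_sqrt hQ).trans_eq (Real.sqrt_sq hR0.le)) (by linarith)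
  have hlow : b * Real.sin (Real.pi * b / 2) * R ^ (b - 1) ≤
      b * (swallowPow b (b - 1) (x * y⁻¹)).re * y ^ (b - 1) := by
    calc b * Real.sin (Real.pi * b / 2) * R ^ (b - 1)
        ≤ b * Real.sin (Real.pi * b / 2) * Real.sqrt (x ^ 2 + y ^ 2) ^ (b - 1) :=
          mul_le_mul_of_nonneg_left h3 (mul_nonneg hb0 hsin)
      _ = b * (Real.sin (Real.pi * b / 2) * ‖((x * y⁻¹ : ℝ) : ℂ) + I‖ ^ (b - 1)) * y ^ (b - 1) := by
          rw [← h2]; ring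
      _ ≤ b * (swallowPow b (b - 1) (x * y⁻¹)).re * y ^ (b - 1) :=
          mul_le_mul_of_nonneg_right (mul_le_mul_of_nonneg_left h1 hb0)
            (Real.rpow_pos_of_pos hypos _).le
  have hlow0 : 0 ≤ b * Real.sin (Real.pi * b / 2) * R ^ (b - 1) :=
    mul_nonneg (mul_nonneg hb0 hsin) (Real.rpow_pos_of_pos hR0 _).le
  have hsq := mul_self_le_mul_self hlow0 hlow
  have hyb : y⁻¹ * y ^ b = y ^ (b - 1) := by
    rw [Real.rpow_sub_one hypos.ne', div_eq_inv_mul]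
  have hexpr : -Real.sqrt κ * y⁻¹ * (b * (swallowPow b (b - 1) (x * y⁻¹)).re) * y ^ b =
      -Real.sqrt κ * (b * (swallowPow b (b - 1) (x * y⁻¹)).re * y ^ (b - 1)) := by
    rw [← hyb]; ring
  rw [hexpr]
  have hsq' : (b * Real.sin (Real.pi * b / 2) * R ^ (b - 1)) ^ 2 ≤
      (b * (swallowPow b (b - 1) (x * y⁻¹)).re * y ^ (b - 1)) ^ 2 := by rw [sq, sq]; exact hsq
  have heq : (-Real.sqrt κ * (b * (swallowPow b (b - 1) (x * y⁻¹)).re * y ^ (b - 1))) ^ 2 =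
      (κ : ℝ) * (b * (swallowPow b (b - 1) (x * y⁻¹)).re * y ^ (b - 1)) ^ 2 := by
    rw [mul_pow, neg_sq, Real.sq_sqrt κ.coe_nonneg]
  rw [heq]
  exact mul_le_mul_of_nonneg_left hsq' κ.coe_nonneg

/-- **`P[σ_{R,n} ≥ t] ≤ 4R^{2b}/(κ (b sin(πb/2) R^{b-1})² t)`**: the second moment of the
bounded drift-free observable `Re(θ z^b_{t∧σ})` is `E∫₀ᵗ D² ds ≤ 4R^{2b}`
(`integral_sq_sub_eq_integral_sq_swallowObsDiffusion`), and `∫₀ᵗ D² ds ≥ c_R t` on `{σ ≥ t}`.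
(This replaces the "sprint time" estimate `P[τ_R > T] < ε/2` of the printed proof.)
[cite: RohdeSchramm2005, Lemma 6.5 (proof)] -/
theorem measureReal_le_exitLocTime_le (hκ : 4 < κ) (hz : 0 < z.im) {R : ℝ} (hR0 : 0 < R)
    (hR : Complex.normSq z < R ^ 2) (n : ℕ) {t : ℝ≥0} (ht : 0 < t) :
    preWienerMeasure.real {ω | (t : WithTop ℝ≥0) ≤ slePointExitLocTime κ z R n ω} ≤
      4 * R ^ (2 * (1 - 4 / (κ : ℝ))) /
        ((κ : ℝ) * ((1 - 4 / (κ : ℝ)) * Real.sin (Real.pi * (1 - 4 / (κ : ℝ)) / 2) *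
          R ^ (1 - 4 / (κ : ℝ) - 1)) ^ 2) / t := by
  haveI := isProbabilityMeasure_preWienerMeasure'
  have hκ0 : 0 < κ := lt_trans (by norm_num) hκ
  have hκ0' : (κ : ℝ) ≠ 0 := by positivity
  have hκpos : (0 : ℝ) < κ := by positivity
  set b : ℝ := 1 - 4 / (κ : ℝ) with hb
  obtain ⟨hb0, hb1⟩ := rsB_mem hκ
  set σ := slePointExitLocTime κ z R n with hσdef
  have hσ : IsStoppingTime brownianFiltration σ := isStoppingTime_slePointExitLocTime hz
  have hσρ : ∀ ω, σ ω ≤ slePointLocTime κ z n ω := slePointExitLocTime_le_locTime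
  have hS := abs_cotArg_le_of_le (κ := κ) (n := n) hz hR0 hR
  have hode : ∀ w : ℝ, (κ : ℝ) / 2 * (1 + w ^ 2) * iteratedDeriv 2 (swallowRe b) w +
      4 * w * deriv (swallowRe b) w - 2 * b * swallowRe b w = 0 := fun w ↦ swallowRe_ode hκ0' rfl w
  have hF := contDiff_two_swallowRe b
  have hC := abs_swallowObs_re_le (κ := κ) hz hR0 hR (n := n) hb0.le
  obtain ⟨hIint, hI⟩ := integral_sq_sub_eq_integral_sq_swallowObsDiffusion hκ0 hz hF hode hσ hσρ hS hC t
  set D := swallowObsDiffusion κ z σ (swallowRe b) b with hDdef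
  set I : (ℝ≥0 → ℝ) → ℝ := fun ω ↦ ∫ s in (0 : ℝ)..t, D s.toNNReal ω ^ 2 with hIdef
  set c : ℝ := (κ : ℝ) * (b * Real.sin (Real.pi * b / 2) * R ^ (b - 1)) ^ 2 with hc
  have hsin : 0 < Real.sin (Real.pi * b / 2) :=
    Real.sin_pos_of_pos_of_lt_pi (by positivity) (by nlinarith [Real.pi_pos])
  have hcpos : 0 < c := by positivity
  -- second moment bound: `E[I] ≤ 4 R^{2b}`
  have hE : ∫ ω, I ω ∂preWienerMeasure ≤ 4 * R ^ (2 * b) := by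
    rw [← hI]
    have hbound : ∀ ω, (swallowObs κ z σ (swallowRe b) b t ω - swallowRe b (z.re / z.im) * z.im ^ b) ^ 2 ≤
        4 * R ^ (2 * b) := by
      intro ω
      have h1 := hC t ω
      have h2 := hC 0 ω
      rw [swallowObs_zero hz] at h2
      have h3 : |swallowObs κ z σ (swallowRe b) b t ω - swallowRe b (z.re / z.im) * z.im ^ b| ≤ 2 * R ^ b :=
        (abs_sub _ _).trans (by linarith)
      have h4 := pow_le_pow_left₀ (abs_nonneg _) h3 2
      rw [sq_abs] at h4
      calc _ ≤ (2 * R ^ b) ^ 2 := h4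
        _ = 4 * R ^ (2 * b) := by
            rw [mul_pow, ← Real.rpow_natCast (R ^ b) 2, ← Real.rpow_mul hR0.le]
            push_cast; ring
    have hmeas : AEStronglyMeasurable (fun ω ↦ (swallowObs κ z σ (swallowRe b) b t ω -
        swallowRe b (z.re / z.im) * z.im ^ b) ^ 2) preWienerMeasure :=
      ((((stronglyAdapted_swallowObs hz hF.continuous hσ t).mono (brownianFiltration.le t)).measurable.sub
        measurable_const).pow_const 2).aestronglyMeasurable
    have := integral_mono_of_nonneg (ae_of_all _ fun ω ↦ sq_nonneg _) (integrable_const (4 * R ^ (2 * b)))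
      (ae_of_all _ hbound) (μ := preWienerMeasure)
      (f := fun ω ↦ (swallowObs κ z σ (swallowRe b) b t ω - swallowRe b (z.re / z.im) * z.im ^ b) ^ 2)
    simpa only [MeasureTheory.integral_const, smul_eq_mul, probReal_univ, one_mul] using this
  -- lower bound for `I` on `{σ ≥ t}`
  have hDp := isStronglyProgressive_swallowObsDiffusion (b := b) hz (hF.continuous_deriv (by norm_num)) hσ hσρ
  obtain ⟨CD, hDC⟩ := exists_abs_swallowObsDiffusion_le (b := b) hz (hF.continuous_deriv (by norm_num)) hσρ hS
  set B : Set (ℝ≥0 → ℝ) := {ω | (t : WithTop ℝ≥0) ≤ σ ω} with hBdef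
  have hBm : MeasurableSet B := by
    have h1 : MeasurableSet[brownianFiltration t] {ω | σ ω < t} := hσ.measurableSet_lt t
    have h2 : B = {ω | σ ω < t}ᶜ := by ext ω; simp [hBdef, not_lt]
    rw [h2]
    exact (brownianFiltration.le t _ h1).compl
  have hIlow : ∀ ω ∈ B, c * t ≤ I ω := by
    intro ω hω
    have hle : ∀ s ∈ Icc (0 : ℝ) t, c ≤ D s.toNNReal ω ^ 2 := by
      intro s hs
      have hsσ : ((s.toNNReal : ℝ≥0) : WithTop ℝ≥0) ≤ σ ω :=
        (WithTop.coe_le_coe.2 (Real.toNNReal_le_iff_le_coe.2 hs.2)).trans hω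
      exact le_sq_swallowObsDiffusion_re hz hR0 hR hb0.le hb1.le hsσ
    have hDint : IntervalIntegrable (fun s : ℝ ↦ D s.toNNReal ω ^ 2) volume 0 t := by
      refine (intervalIntegrable_iff_integrableOn_Icc_of_le (NNReal.coe_nonneg t)).2
        (Measure.integrableOn_of_bounded (M := CD ^ 2) measure_Icc_lt_top.ne
        ((measurable_path_of_isStronglyProgressive hDp ω).pow_const 2).aestronglyMeasurable
        (ae_of_all _ fun s ↦ ?_))
      rw [Real.norm_eq_abs, abs_pow, sq_abs, ← sq_abs]
      exact pow_le_pow_left₀ (abs_nonneg _) (hDC _ ω) 2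
    have h1 := intervalIntegral.integral_mono_on (NNReal.coe_nonneg t) intervalIntegrable_const hDint hle
    rw [intervalIntegral.integral_const, sub_zero, smul_eq_mul, mul_comm] at h1
    exact h1
  have hInonneg : ∀ ω, 0 ≤ I ω := fun ω ↦
    intervalIntegral.integral_nonneg (NNReal.coe_nonneg t) fun s _ ↦ sq_nonneg _
  -- `c t P(B) ≤ E[I] ≤ 4 R^{2b}`
  have hkey : c * t * preWienerMeasure.real B ≤ 4 * R ^ (2 * b) := by
    have h1 : ∫ ω, (c * t) * B.indicator (fun _ ↦ (1 : ℝ)) ω ∂preWienerMeasure = c * t * preWienerMeasure.real B := by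
      rw [MeasureTheory.integral_const_mul, integral_indicator_const _ hBm, smul_eq_mul, mul_one]
    rw [← h1]
    refine le_trans (integral_mono ((integrable_const (1 : ℝ)).indicator hBm |>.const_mul (c * t)) hIint
      fun ω ↦ ?_) hE
    by_cases hω : ω ∈ B
    · rw [indicator_of_mem hω, mul_one]; exact hIlow ω hω
    · rw [indicator_of_notMem hω, mul_zero]; exact hInonneg ω
  have hct : 0 < c * t := mul_pos hcpos ht
  rw [div_div, le_div_iff₀ (by positivity)]
  calc preWienerMeasure.real B * ((κ : ℝ) * (b * Real.sin (Real.pi * b / 2) * R ^ (b - 1)) ^ 2 * t)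
      = c * t * preWienerMeasure.real B := by simp only [hc]; ring
    _ ≤ 4 * R ^ (2 * b) := hkey

/-- **No eternal confinement**: for `κ > 4`, `z ∈ ℍ` and `R > |z|`, the event
"`τ(z) = ∞` and `|zₜ| < R` for all `t`" is null. On it, for every `n` the gauge never exits, so
`σ_{R,n} = ρₙ`, and `ρₙ ≥ t` for all large `n` (`exists_le_slePointLocTime`); but
`P[σ_{R,n} ≥ t] ≤ C_R/t` (`measureReal_le_exitLocTime_le`). [cite: RohdeSchramm2005, Lemma 6.5 (proof)] -/
theorem measure_confined_eq_zero (hκ : 4 < κ) (hz : 0 < z.im) {R : ℝ} (hR0 : 0 < R)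
    (hR : Complex.normSq z < R ^ 2) :
    preWienerMeasure {ω | swallowingTime (sleDriving κ ω) z = ⊤ ∧
      ∀ t : ℝ≥0, Complex.normSq (centredMap (sleDriving κ ω) t z) < R ^ 2} = 0 := by
  haveI := isProbabilityMeasure_preWienerMeasure'
  set b : ℝ := 1 - 4 / (κ : ℝ) with hb
  set M : ℝ := 4 * R ^ (2 * b) / ((κ : ℝ) * (b * Real.sin (Real.pi * b / 2) * R ^ (b - 1)) ^ 2) with hM
  set Cset := {ω : ℝ≥0 → ℝ | swallowingTime (sleDriving κ ω) z = ⊤ ∧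
      ∀ t : ℝ≥0, Complex.normSq (centredMap (sleDriving κ ω) t z) < R ^ 2} with hCset
  -- for every `t > 0`: `μ C ≤ M / t`
  have hbound : ∀ t : ℝ≥0, 0 < t → preWienerMeasure Cset ≤ ENNReal.ofReal (M / t) := by
    intro t ht
    set B : ℕ → Set (ℝ≥0 → ℝ) := fun n ↦ {ω | (t : WithTop ℝ≥0) ≤ slePointExitLocTime κ z R n ω} with hBdef
    set V : ℕ → Set (ℝ≥0 → ℝ) := fun N ↦ ⋂ n, ⋂ (_ : N ≤ n), B n with hVdef
    have hVmono : Monotone V := fun N N' hNN' ω hω ↦ by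
      simp only [hVdef, mem_iInter] at hω ⊢
      exact fun n hn ↦ hω n (hNN'.trans hn)
    have hsub : Cset ⊆ ⋃ N, V N := by
      rintro ω ⟨hT, hconf⟩
      -- the gauge never exits: `σ_{R,n} = ρₙ`
      have hσ : ∀ n, slePointExitLocTime κ z R n ω = slePointLocTime κ z n ω := by
        intro n
        have htop : slePointExitTime κ z R n ω = ⊤ := by
          by_contra hne
          obtain ⟨T₀, hT₀⟩ := WithTop.ne_top_iff_exists.1 hne
          have hout := notMem_Ioo_of_exitTime_eq_coe (continuous_slePointNormSqStop hz ω) hT₀.symm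
            (u := slePointNormSqStop κ z n) (a := -1) (b := R ^ 2)
          apply hout
          rw [slePointNormSqStop_eq hz]
          refine ⟨?_, hconf _⟩
          have := Complex.normSq_nonneg (centredMap (sleDriving κ ω)
            ((min (T₀ : WithTop ℝ≥0) (slePointLocTime κ z n ω)).untopA) z)
          linarith
        rw [slePointExitLocTime, htop, min_eq_right le_top]
      have ht' : (t : WithTop ℝ≥0) < swallowingTime (sleDriving κ ω) z := by rw [hT]; exact WithTop.coe_lt_top t
      obtain ⟨N, hN⟩ := exists_le_slePointLocTime hz ω ht'
      refine mem_iUnion.2 ⟨N, ?_⟩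
      simp only [hVdef, hBdef, mem_iInter, mem_setOf_eq]
      intro n hn
      rw [hσ n]
      exact hN n hn
    refine (measure_mono hsub).trans ?_
    rw [hVmono.measure_iUnion]
    refine iSup_le fun N ↦ ?_
    have hVB : V N ⊆ B N := fun ω hω ↦ by
      simp only [hVdef, mem_iInter] at hω
      exact hω N le_rfl
    refine (measure_mono hVB).trans ?_
    rw [← ENNReal.ofReal_toReal (measure_ne_top _ _)]
    exact ENNReal.ofReal_le_ofReal (measureReal_le_exitLocTime_le hκ hz hR0 hR N ht)
  -- `M / (k+1) → 0`
  have hlim : Tendsto (fun k : ℕ ↦ ENNReal.ofReal (M / ((k : ℝ≥0) + 1 : ℝ≥0))) atTop (𝓝 0) := by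
    rw [← ENNReal.ofReal_zero]
    refine ENNReal.tendsto_ofReal ?_
    have h1 : Tendsto (fun k : ℕ ↦ M * (1 / ((k : ℝ) + 1))) atTop (𝓝 (M * 0)) :=
      tendsto_one_div_add_atTop_nhds_zero_nat.const_mul M
    rw [mul_zero] at h1
    refine h1.congr fun k ↦ ?_
    push_cast
    ring
  refine le_antisymm (ge_of_tendsto' hlim fun k ↦ hbound _ (by positivity)) bot_le

/-- **Rohde–Schramm (2005), Lemma 6.5, interior points (proved)**: for `κ > 4` and `z ∈ ℍ`, almost
surely `τ(z) < ∞`. For every `R > |z|`, `{τ(z) = ∞}` is covered by the null confinement event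
(`measure_confined_eq_zero`) and the exit event of probability `≤ |z|^b/(cos(πb/2) R^b)`
(`measure_exists_normSq_ge_le`), which tends to `0` as `R → ∞` (`b = 1 - 4/κ > 0`).
[cite: RohdeSchramm2005, Lemma 6.5] -/
theorem ae_swallowingTime_lt_top_of_im_pos (hκ : 4 < κ) (hz : 0 < z.im) :
    ∀ᵐ ω ∂preWienerMeasure, swallowingTime (sleDriving κ ω) z < ⊤ := by
  haveI := isProbabilityMeasure_preWienerMeasure'
  set b : ℝ := 1 - 4 / (κ : ℝ) with hb
  obtain ⟨hb0, hb1⟩ := rsB_mem hκ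
  set A : ℝ := Real.sqrt (z.re ^ 2 + z.im ^ 2) ^ b with hA
  set cb : ℝ := Real.cos (Real.pi * b / 2) with hcb
  have hcos : 0 < cb := by
    refine Real.cos_pos_of_mem_Ioo ⟨by nlinarith [Real.pi_pos], ?_⟩
    nlinarith [Real.pi_pos]
  rw [ae_iff]
  set E := {ω : ℝ≥0 → ℝ | ¬ swallowingTime (sleDriving κ ω) z < ⊤} with hE
  -- radii `R_k = √(normSq z) + k + 1`
  set r₀ : ℝ := Real.sqrt (Complex.normSq z) with hr₀
  have hr₀nn : 0 ≤ r₀ := Real.sqrt_nonneg _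
  have hbound : ∀ k : ℕ, preWienerMeasure E ≤ ENNReal.ofReal (A / (cb * (r₀ + k + 1) ^ b)) := by
    intro k
    set R : ℝ := r₀ + k + 1 with hRdef
    have hR0 : 0 < R := by positivity
    have hR : Complex.normSq z < R ^ 2 := by
      have h1 : Complex.normSq z = r₀ ^ 2 := (Real.sq_sqrt (Complex.normSq_nonneg z)).symm
      rw [h1]
      exact pow_lt_pow_left₀ (by linarith) hr₀nn two_ne_zero
    have hsub : E ⊆ {ω | swallowingTime (sleDriving κ ω) z = ⊤ ∧
        ∀ t : ℝ≥0, Complex.normSq (centredMap (sleDriving κ ω) t z) < R ^ 2} ∪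
        {ω | ∃ t : ℝ≥0, (t : WithTop ℝ≥0) < swallowingTime (sleDriving κ ω) z ∧
          R ^ 2 ≤ Complex.normSq (centredMap (sleDriving κ ω) t z)} := by
      intro ω hω
      simp only [hE, mem_setOf_eq, not_lt, top_le_iff] at hω
      by_cases hconf : ∀ t : ℝ≥0, Complex.normSq (centredMap (sleDriving κ ω) t z) < R ^ 2
      · exact Or.inl ⟨hω, hconf⟩
      · push Not at hconf
        obtain ⟨t, ht⟩ := hconf
        exact Or.inr ⟨t, by rw [hω]; exact WithTop.coe_lt_top t, ht⟩
    calc preWienerMeasure E ≤ _ := measure_mono hsub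
      _ ≤ _ := measure_union_le _ _
      _ ≤ 0 + ENNReal.ofReal (A / (cb * R ^ b)) :=
          add_le_add (measure_confined_eq_zero hκ hz hR0 hR).le (measure_exists_normSq_ge_le hκ hz hR0 hR)
      _ = ENNReal.ofReal (A / (cb * (r₀ + k + 1) ^ b)) := by rw [zero_add]
  -- the bound tends to `0`
  have hlim : Tendsto (fun k : ℕ ↦ ENNReal.ofReal (A / (cb * (r₀ + k + 1) ^ b))) atTop (𝓝 0) := by
    rw [← ENNReal.ofReal_zero]
    refine ENNReal.tendsto_ofReal ?_
    have h1 : Tendsto (fun k : ℕ ↦ (r₀ + k + 1 : ℝ)) atTop atTop := by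
      have : Tendsto (fun k : ℕ ↦ ((k : ℝ) + (r₀ + 1))) atTop atTop :=
        tendsto_atTop_add_const_right _ _ tendsto_natCast_atTop_atTop
      refine this.congr fun k ↦ by ring
    have h2 : Tendsto (fun k : ℕ ↦ cb * (r₀ + k + 1 : ℝ) ^ b) atTop atTop :=
      Tendsto.const_mul_atTop hcos ((tendsto_rpow_atTop hb0).comp h1)
    have h3 := h2.inv_tendsto_atTop.const_mul A
    rw [mul_zero] at h3
    refine h3.congr fun k ↦ ?_
    simp only [Pi.inv_apply]
    rw [div_eq_mul_inv]
  exact le_antisymm (ge_of_tendsto' hlim hbound) bot_le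

end Confinement

/-! ### Discharge of the named facts (Lemma 6.5 as printed; Thm 6.4, first half) -/

section Named

variable {κ : ℝ≥0}

/-- **Rohde–Schramm (2005), Lemma 6.5 (proved)**: discharge of the named fact
`ae_swallowingTime_lt_top_of_four_lt` — for `κ > 4` and `z ∈ ℍ̄ ∖ {0}`, almost surely
`τ(z) < ∞`. Interior points: `ae_swallowingTime_lt_top_of_im_pos`; real points: Lawler's
one-point martingales and reflection (`ae_sle_swallowingTime_ofReal_lt_top`, tree).
[cite: RohdeSchramm2005, Lemma 6.5] -/
theorem ae_swallowingTime_lt_top_of_four_lt_holds : ae_swallowingTime_lt_top_of_four_lt := by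
  intro κ hκ z hzim hz0
  rcases hzim.lt_or_eq with him | him
  · exact ae_swallowingTime_lt_top_of_im_pos hκ him
  · have hre : z.re ≠ 0 := fun h ↦ hz0 (Complex.ext h him.symm)
    have hz : ((z.re : ℝ) : ℂ) = z := Complex.ext rfl (by rw [Complex.ofReal_im]; exact him)
    have := ae_sle_swallowingTime_ofReal_lt_top hκ hre
    rwa [hz] at this

/-- **Rohde–Schramm (2005), Thm 6.4, first half (proved)**: discharge of the named fact
`ae_isSwallowed_sleTrace` — for `4 < κ < 8` and `z ∈ ℍ̄ ∖ {0}`, almost surely `z` is swallowed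
(`z ∉ γ[0, ∞)` and `τ(z) < ∞`): the tree's reduction `ae_isSwallowed_sleTrace_of_lemma65`
(`CritPercSLESwallowedProofs.lean`: Lemma 6.3 + Koebe for interior points, the same-side
swallowing estimate of Lemma 6.6 for real points, junk trace off curves) fed with Lemma 6.5
(`ae_swallowingTime_lt_top_of_four_lt_holds`), exactly as in the printed proof (p. 908).
[cite: RohdeSchramm2005, Thm 6.4] -/
theorem ae_isSwallowed_sleTrace_holds : ae_isSwallowed_sleTrace :=
  ae_isSwallowed_sleTrace_of_lemma65 ae_swallowingTime_lt_top_of_four_lt_holds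

end Named

end Literature.Probability.RandomPlanarGeometry
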